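import Summits.BirchSwinnertonDyer.BirchSwinnertonDyer.Theorems.ClassRecordThreeEulerHalvesAtThreeCartanTorusCubeCutPSUnipotent
import HarnessLib

/-!
# Crux 23422 line `cartan` v8′, stub (F2a), PRINCIPAL-SERIES half of the torus-cube cut — file PS-4b: the CUBE RELATION on `X^U`:
# `(1 + ρ(d₀) + ρ(d₀)²)·x = 0` for every `U`-fixed `x` and every non-cube `d₀ = diag(a,1)` (`q ≡ 1 (mod 3)`)

Seat `bsd-stepL-cartan-f2a` g0 (explicit unit, pen g44 AUTOFILL #2 row (3′); `--supports stmt-BirchSwinnertonDyer-23422 --as helper`).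
With `N_U = Σ_y ρ(u(y))` (abstract unipotent parametrisation, file PS-4), `C = {x : x^k = 1}` (`k = (q−1)/3`, `|C| = k`) and
`N_C = Σ_{x∈C} ρ(diag(x,1))`:
* `normC_comp_normU_eq` : `N_C ∘ N_U = k·N_U` — the cube-mirabolic group `H_C = {diag(x,1)u(y) : x ∈ C}` has character sum `2q·k = 2|H_C|`,
  so `A = N_{H_C} = N_C N_U` and `B = k N_U` satisfy `(B − A)² = kq(B − A)`, `tr(B − A) = 0`, hence `A = B` (PS-1 trace lemma);
* `rho_cube_comp_normU` : `ρ(diag(b,1)) ∘ N_U = N_U` for every cube `b`;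
* `sum_rho_diagGL_comp_normU` : `Σ_x ρ(diag(x,1)) N_U = k·(1 + ρ(d₀) + ρ(d₀)²) N_U` for a non-cube `d₀ = diag(a,1)` (coset decomposition
  `𝔽_q^× = C ⊔ aC ⊔ a²C`, `cosetEquiv`), and the left side vanishes (`normD_comp_normU_eq_zero`, PS-4);
* **`cube_relation_of_unipotentFixed`** : `x + ρ(d₀)x + ρ(d₀)²x = 0` for every `x` fixed by all upper unipotents — the lattice half of
  the hypothesis `hcube` of `psNonsplitNormSharp_of_line` (PS-3c); `exists_nonCube` : a non-cube exists (`k < q − 1`).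
HONEST FRAMING: finite-group averaging on one lattice; S-K1′ is NOT proved, no summit statement, no route item and no registered stub is
proved; BSD is proved for no curve. [folklore]
-/

namespace Summit.BirchSwinnertonDyer.BirchSwinnertonDyer.Theorems.CartanTorusCubeCut.PS

open Summit.BirchSwinnertonDyer.BirchSwinnertonDyer.Theorems.CartanDegree
open Summit.BirchSwinnertonDyer.BirchSwinnertonDyer.Theorems.CartanTorusCubeCut

set_option linter.dupNamespace false
set_option autoImplicit false

section Cube
variable {q : ℕ} [Fact q.Prime]
variable (u : ZMod q → G q) (hu : ∀ y, ((u y : G q) : Mat q) = !![1, y; 0, 1])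

/-- powers of `diag(a,1)`. -/
theorem diagGL_mirabolic_pow (a : (ZMod q)ˣ) (i : ℕ) : (diagGL ![a, 1]) ^ i = diagGL ![a ^ i, 1] := by
  induction i with
  | zero =>
    rw [pow_zero, pow_zero]
    have : (![1, 1] : Fin 2 → (ZMod q)ˣ) = 1 := by funext j; fin_cases j <;> rfl
    rw [this, diagGL, map_one, map_one]
  | succ i ih => rw [pow_succ, ih, diagGL_mirabolic_mul, pow_succ]

/-- the cube test is multiplicative: cubes are closed under multiplication. -/
theorem cube_mul {x x' : (ZMod q)ˣ} (hx : (x : ZMod q) ^ ((q - 1) / 3) = 1) (hx' : (x' : ZMod q) ^ ((q - 1) / 3) = 1) :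
    ((x * x' : (ZMod q)ˣ) : ZMod q) ^ ((q - 1) / 3) = 1 := by
  rw [Units.val_mul, mul_pow, hx, hx', one_mul]

variable (𝓛 : CartanTorusLattice q)
include hu

/-- `tr N_U = 2q` (`q ≡ 1 (mod 3)`). -/
theorem trace_normU (h1 : q % 3 = 1) : LinearMap.trace ℤ _ (∑ y : ZMod q, 𝓛.ρ (u y)) = 2 * (q : ℤ) := by
  have h := sum_char_unipotent_fibre u hu h1 1
  simp only [Units.val_one, one_pow, if_true] at h
  have e : ∀ y, diagGL ![(1 : (ZMod q)ˣ), 1] * u y = u y := by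
    intro y
    have : (![1, 1] : Fin 2 → (ZMod q)ˣ) = 1 := by funext j; fin_cases j <;> rfl
    rw [this, diagGL, map_one, map_one, one_mul]
  simp only [e] at h
  rw [map_sum, Finset.sum_congr rfl (fun y _ => 𝓛.trace_eq (u y)), h, mul_comm]

/-- **`N_C ∘ N_U = k·N_U`** with `C` the cubes (`|C| = k = (q−1)/3`): the cube-mirabolic group `H_C` has `tr N_{H_C} = 2|H_C|`. -/
theorem normC_comp_normU_eq (h1 : q % 3 = 1) :
    (∑ x ∈ Finset.univ.filter (fun x : (ZMod q)ˣ => (x : ZMod q) ^ ((q - 1) / 3) = 1), 𝓛.ρ (diagGL ![x, 1])) *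
        (∑ y : ZMod q, 𝓛.ρ (u y)) =
      (((q - 1) / 3 : ℕ) : ℤ) • ∑ y : ZMod q, 𝓛.ρ (u y) := by
  classical
  have hq : q.Prime := Fact.out
  set k : ℕ := (q - 1) / 3 with hk
  set C := Finset.univ.filter (fun x : (ZMod q)ˣ => (x : ZMod q) ^ k = 1) with hC
  have hCcard : C.card = k := card_cubeRoots h1
  have hk0 : k ≠ 0 := by have := hq.two_le; omega
  set NU := ∑ y : ZMod q, 𝓛.ρ (u y) with hNU
  set NC := ∑ x ∈ C, 𝓛.ρ (diagGL ![x, 1]) with hNC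
  -- the cube-mirabolic group
  set H : Finset (G q) := (C ×ˢ (Finset.univ : Finset (ZMod q))).image
    (fun p : (ZMod q)ˣ × ZMod q => diagGL ![p.1, 1] * u p.2) with hH
  have hinj := diagGL_mul_unipotentParam_injective u hu
  have hNH : normOp 𝓛 H = NC * NU := by
    rw [normOp, hH, Finset.sum_image (fun p _ p' _ h => hinj h), Finset.sum_product, hNC, Finset.sum_mul]
    refine Finset.sum_congr rfl fun x _ => ?_
    rw [hNU, Finset.mul_sum]
    refine Finset.sum_congr rfl fun y _ => ?_
    rw [map_mul]
  have hHmul : ∀ g ∈ H, ∀ g' ∈ H, g * g' ∈ H := by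
    intro g hg g' hg'
    rw [hH, Finset.mem_image] at hg hg' ⊢
    obtain ⟨p, hp, rfl⟩ := hg
    obtain ⟨p', hp', rfl⟩ := hg'
    rw [Finset.mem_product] at hp hp'
    refine ⟨(p.1 * p'.1, ((p'.1⁻¹ : (ZMod q)ˣ) : ZMod q) * p.2 + p'.2), ?_,
      (diagGL_mul_unipotentParam_mul u hu p.1 p'.1 p.2 p'.2).symm⟩
    rw [Finset.mem_product]
    refine ⟨?_, Finset.mem_univ _⟩
    rw [hC, Finset.mem_filter] at hp hp' ⊢
    exact ⟨Finset.mem_univ _, cube_mul hp.1.2 hp'.1.2⟩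
  have hHcard : H.card = k * q := by
    rw [hH, Finset.card_image_of_injective _ hinj, Finset.card_product, hCcard, Finset.card_univ, ZMod.card]
  -- `A = N_H`, `B = k • N_U`
  have hAA : (NC * NU) * (NC * NU) = ((k * q : ℕ) : ℤ) • (NC * NU) := by
    rw [← hNH, ← hHcard]; exact normOp_mul_self 𝓛 hHmul
  have hUU : NU * NU = (q : ℤ) • NU := normU_mul_self u hu 𝓛
  have hcomm : NU * NC = NC * NU := by
    rw [hNC, Finset.mul_sum, Finset.sum_mul]
    refine Finset.sum_congr rfl fun x _ => ?_
    rw [hNU]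
    exact (rho_diagGL_comp_normU u hu 𝓛 x).symm
  have htrA : LinearMap.trace ℤ _ (NC * NU) = 2 * (q : ℤ) * k := by
    rw [← hNH, trace_normOp, hH, Finset.sum_image (fun p _ p' _ h => hinj h), Finset.sum_product]
    have : ∀ x ∈ C, ∑ y : ZMod q, cubicNewvectorChar q (diagGL ![x, 1] * u y) = 2 * (q : ℤ) := by
      intro x hx
      rw [hC, Finset.mem_filter] at hx
      rw [sum_char_unipotent_fibre u hu h1, if_pos hx.2, mul_comm]
    rw [Finset.sum_congr rfl this, Finset.sum_const, hCcard, nsmul_eq_mul]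
    ring
  have htrB : LinearMap.trace ℤ _ ((k : ℤ) • NU) = 2 * (q : ℤ) * k := by
    rw [map_zsmul, hNU, trace_normU u hu 𝓛 h1, smul_eq_mul]; ring
  set Q := (k : ℤ) • NU - NC * NU with hQ
  have hQQ : Q * Q = ((k * q : ℕ) : ℤ) • Q := by
    have e1 : ((k : ℤ) • NU) * ((k : ℤ) • NU) = ((k * q : ℕ) : ℤ) • ((k : ℤ) • NU) := by
      rw [smul_mul_smul_comm, hUU, smul_smul, smul_smul]; push_cast; ring_nf
    have e2 : ((k : ℤ) • NU) * (NC * NU) = ((k * q : ℕ) : ℤ) • (NC * NU) := by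
      rw [smul_mul_assoc, ← mul_assoc, hcomm, mul_assoc, hUU, mul_smul_comm, smul_smul]; push_cast; ring_nf
    have e3 : (NC * NU) * ((k : ℤ) • NU) = ((k * q : ℕ) : ℤ) • (NC * NU) := by
      rw [mul_smul_comm, mul_assoc, hUU, mul_smul_comm, smul_smul]; push_cast; ring_nf
    rw [hQ, sub_mul, mul_sub, mul_sub, e1, e2, e3, hAA, smul_sub]
    abel
  have hQtr : LinearMap.trace ℤ _ Q = 0 := by
    rw [hQ, map_sub, htrB, htrA, sub_self]
  have hkq : ((k * q : ℕ) : ℤ) ≠ 0 := by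
    have : k * q ≠ 0 := Nat.mul_ne_zero hk0 hq.ne_zero
    exact_mod_cast this
  have := eq_zero_of_mul_self_eq_smul_of_trace_eq_zero Q _ hkq hQQ hQtr
  rw [hQ, sub_eq_zero] at this
  exact this.symm

/-- **cubes act trivially on `N_U X`**: `ρ(diag(b,1)) ∘ N_U = N_U` for `b^k = 1`. -/
theorem rho_cube_comp_normU (h1 : q % 3 = 1) {b : (ZMod q)ˣ} (hb : (b : ZMod q) ^ ((q - 1) / 3) = 1) :
    𝓛.ρ (diagGL ![b, 1]) * (∑ y : ZMod q, 𝓛.ρ (u y)) = ∑ y : ZMod q, 𝓛.ρ (u y) := by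
  classical
  have hq : q.Prime := Fact.out
  have hk0 : (((q - 1) / 3 : ℕ) : ℤ) ≠ 0 := by have := hq.two_le; exact_mod_cast (by omega : (q - 1) / 3 ≠ 0)
  have key := normC_comp_normU_eq u hu 𝓛 h1
  set C := Finset.univ.filter (fun x : (ZMod q)ˣ => (x : ZMod q) ^ ((q - 1) / 3) = 1) with hC
  -- `ρ(d_b) N_C = N_C` by reindexing the cubes
  have hbC : 𝓛.ρ (diagGL ![b, 1]) * (∑ x ∈ C, 𝓛.ρ (diagGL ![x, 1])) = ∑ x ∈ C, 𝓛.ρ (diagGL ![x, 1]) := by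
    rw [Finset.mul_sum]
    simp_rw [← map_mul, diagGL_mirabolic_mul]
    refine Finset.sum_nbij' (fun x => b * x) (fun x => b⁻¹ * x) (fun x hx => ?_) (fun x hx => ?_)
      (fun x _ => by simp) (fun x _ => by simp) (fun x _ => rfl)
    · rw [hC, Finset.mem_filter] at hx ⊢
      exact ⟨Finset.mem_univ _, cube_mul hb hx.2⟩
    · rw [hC, Finset.mem_filter] at hx ⊢
      refine ⟨Finset.mem_univ _, cube_mul ?_ hx.2⟩
      rw [Units.val_inv_eq_inv_val, inv_pow, hb, inv_one]
  have h2 := congrArg (fun f => 𝓛.ρ (diagGL ![b, 1]) * f) key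
  rw [← mul_assoc, hbC, key, mul_smul_comm] at h2
  exact (smul_right_injective _ hk0 h2).symm

omit hu in
/-- the coset bijection `{0,1,2} × C ≃ 𝔽_q^×`, `(i, c) ↦ aⁱc`, for a non-cube `a`. -/
theorem cosetMap_bijective (h1 : q % 3 = 1) {a : (ZMod q)ˣ} (ha : (a : ZMod q) ^ ((q - 1) / 3) ≠ 1) :
    Function.Bijective (fun p : Fin 3 × (Finset.univ.filter (fun x : (ZMod q)ˣ => (x : ZMod q) ^ ((q - 1) / 3) = 1)) =>
      a ^ (p.1 : ℕ) * (p.2 : (ZMod q)ˣ)) := by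
  classical
  have hq : q.Prime := Fact.out
  set k : ℕ := (q - 1) / 3 with hk
  have h3k : 3 * k = q - 1 := three_mul_k h1
  -- `ω = a^k` is a primitive cube root of unity
  set ω : ZMod q := (a : ZMod q) ^ k with hω
  have hω3 : ω ^ 3 = 1 := by
    rw [hω, ← pow_mul, mul_comm, h3k, ZMod.pow_card_sub_one_eq_one a.ne_zero]
  have hω1 : ω ≠ 1 := ha
  have hω2 : ω ^ 2 ≠ 1 := by
    intro h
    apply hω1
    have : ω = ω ^ 3 * (ω ^ 2)⁻¹ := by
      have hω0 : ω ≠ 0 := by rw [hω]; exact pow_ne_zero _ a.ne_zero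
      field_simp
    rw [this, hω3, h, inv_one, mul_one]
  -- the `k`-th power separates the three cosets
  have hpow : ∀ (i : Fin 3) (c : (ZMod q)ˣ), (c : ZMod q) ^ k = 1 →
      ((a ^ (i : ℕ) * c : (ZMod q)ˣ) : ZMod q) ^ k = ω ^ (i : ℕ) := by
    intro i c hc
    rw [Units.val_mul, Units.val_pow_eq_pow_val, mul_pow, hc, mul_one, ← pow_mul, mul_comm, pow_mul, ← hω]
  have hω0 : ω ≠ 0 := by rw [hω]; exact pow_ne_zero _ a.ne_zero
  have hω12 : ω ≠ ω ^ 2 := by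
    intro h
    apply hω1
    have : ω * ω = ω * 1 := by rw [mul_one, ← pow_two]; exact h.symm
    exact mul_left_cancel₀ hω0 this
  have hωinj : ∀ i j : ℕ, i < 3 → j < 3 → ω ^ i = ω ^ j → i = j := by
    intro i j hi hj h
    interval_cases i <;> interval_cases j <;> simp only [pow_zero, pow_one] at h <;>
      first
      | rfl
      | exact absurd h.symm hω1
      | exact absurd h hω1
      | exact absurd h.symm hω2
      | exact absurd h hω2
      | exact absurd h hω12
      | exact absurd h.symm hω12
  rw [Fintype.bijective_iff_injective_and_card]
  constructor
  · rintro ⟨i, c, hc⟩ ⟨j, c', hc'⟩ h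
    simp only at h
    have hcC : (c : ZMod q) ^ k = 1 := by simpa using hc
    have hcC' : (c' : ZMod q) ^ k = 1 := by simpa using hc'
    have hij : i = j := by
      apply Fin.ext
      apply hωinj _ _ i.isLt j.isLt
      rw [← hpow i c hcC, ← hpow j c' hcC', h]
    subst hij
    have : c = c' := mul_left_cancel h
    subst this
    rfl
  · rw [Fintype.card_prod, Fintype.card_fin, Fintype.card_coe, card_cubeRoots h1, Fintype.card_units, ZMod.card,
      h3k]

/-- **the coset decomposition of `N_D ∘ N_U`**: `Σ_x ρ(diag(x,1)) N_U = k · (N_U + ρ(d₀)N_U + ρ(d₀)²N_U)` for a non-cube `d₀ = diag(a,1)`. -/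
theorem sum_rho_diagGL_comp_normU (h1 : q % 3 = 1) {a : (ZMod q)ˣ} (ha : (a : ZMod q) ^ ((q - 1) / 3) ≠ 1) :
    (∑ x : (ZMod q)ˣ, 𝓛.ρ (diagGL ![x, 1])) * (∑ y : ZMod q, 𝓛.ρ (u y)) =
      (((q - 1) / 3 : ℕ) : ℤ) • ((∑ y : ZMod q, 𝓛.ρ (u y)) + 𝓛.ρ (diagGL ![a, 1]) * (∑ y : ZMod q, 𝓛.ρ (u y)) +
        𝓛.ρ (diagGL ![a, 1]) * (𝓛.ρ (diagGL ![a, 1]) * (∑ y : ZMod q, 𝓛.ρ (u y)))) := by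
  classical
  set NU := ∑ y : ZMod q, 𝓛.ρ (u y) with hNU
  -- each coset `aⁱC` contributes `k • ρ(d_a)^i N_U`
  have hfib : ∀ i : ℕ,
      ∑ c : (Finset.univ.filter (fun x : (ZMod q)ˣ => (x : ZMod q) ^ ((q - 1) / 3) = 1)),
        𝓛.ρ (diagGL ![a ^ i * (c : (ZMod q)ˣ), 1]) * NU =
      (((q - 1) / 3 : ℕ) : ℤ) • ((𝓛.ρ (diagGL ![a, 1])) ^ i * NU) := by
    intro i
    have : ∀ c : (Finset.univ.filter (fun x : (ZMod q)ˣ => (x : ZMod q) ^ ((q - 1) / 3) = 1)),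
        𝓛.ρ (diagGL ![a ^ i * (c : (ZMod q)ˣ), 1]) * NU = (𝓛.ρ (diagGL ![a, 1])) ^ i * NU := by
      rintro ⟨c, hc⟩
      rw [Finset.mem_filter] at hc
      rw [← diagGL_mirabolic_mul, map_mul, mul_assoc, hNU, rho_cube_comp_normU u hu 𝓛 h1 hc.2,
        ← diagGL_mirabolic_pow, map_pow]
    rw [Finset.sum_congr rfl (fun c _ => this c), Finset.sum_const, Finset.card_univ, Fintype.card_coe,
      card_cubeRoots h1, Nat.cast_smul_eq_nsmul]
  rw [Finset.sum_mul,
    ← Fintype.sum_equiv (Equiv.ofBijective _ (cosetMap_bijective h1 ha))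
      (fun p => 𝓛.ρ (diagGL ![a ^ (p.1 : ℕ) * (p.2 : (ZMod q)ˣ), 1]) * NU) _ (fun _ => rfl),
    Fintype.sum_prod_type, Fin.sum_univ_three]
  simp only [Fin.val_zero, Fin.val_one, Fin.val_two, hfib]
  simp only [pow_zero, one_mul, pow_one, pow_two, mul_assoc, smul_add]

/-- **THE CUBE RELATION** (`q ≡ 1 (mod 3)`): for every vector `x` fixed by all upper unipotents and every non-cube `a`,
`x + ρ(diag(a,1)) x + ρ(diag(a,1))² x = 0` (the `D`-action on `X^U ⊗ ℚ ≅ χ′ ⊕ χ′⁻¹` has no cube-fixed part… concretely: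
`N_D N_U = 0` and the coset decomposition). This is the lattice half of hypothesis `hcube` of `psNonsplitNormSharp_of_line`. -/
theorem cube_relation_of_unipotentFixed (h1 : q % 3 = 1) {a : (ZMod q)ˣ} (ha : (a : ZMod q) ^ ((q - 1) / 3) ≠ 1)
    (x : Fin 𝓛.d → ℤ)
    (hx : ∀ g : G q, (g : Mat q) 1 0 = 0 → (g : Mat q) 0 0 = 1 → (g : Mat q) 1 1 = 1 → 𝓛.ρ g x = x) :
    x + 𝓛.ρ (diagGL ![a, 1]) x + 𝓛.ρ (diagGL ![a, 1]) (𝓛.ρ (diagGL ![a, 1]) x) = 0 := by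
  have hq : q.Prime := Fact.out
  have hNUx : (∑ y : ZMod q, 𝓛.ρ (u y)) x = (q : ℤ) • x := by
    rw [LinearMap.sum_apply]
    have : ∀ y, 𝓛.ρ (u y) x = x := fun y => hx (u y) (by rw [hu]; simp) (by rw [hu]; simp) (by rw [hu]; simp)
    rw [Finset.sum_congr rfl (fun y _ => this y), Finset.sum_const, Finset.card_univ, ZMod.card, Nat.cast_smul_eq_nsmul]
  have h0 := normD_comp_normU_eq_zero u hu 𝓛 h1
  rw [sum_rho_diagGL_comp_normU u hu 𝓛 h1 ha] at h0
  have hk0 : (((q - 1) / 3 : ℕ) : ℤ) ≠ 0 := by have := hq.two_le; exact_mod_cast (by omega : (q - 1) / 3 ≠ 0)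
  have h0' : (∑ y : ZMod q, 𝓛.ρ (u y)) + 𝓛.ρ (diagGL ![a, 1]) * (∑ y : ZMod q, 𝓛.ρ (u y)) +
      𝓛.ρ (diagGL ![a, 1]) * (𝓛.ρ (diagGL ![a, 1]) * (∑ y : ZMod q, 𝓛.ρ (u y))) = 0 := by
    rcases smul_eq_zero.1 h0 with h | h
    · exact absurd h hk0
    · exact h
  have h0x := congrArg (fun f => f x) h0'
  simp only [LinearMap.add_apply, Module.End.mul_apply, LinearMap.zero_apply, hNUx, map_zsmul] at h0x
  rw [← smul_add, ← smul_add] at h0x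
  rcases smul_eq_zero.1 h0x with h | h
  · exact absurd h (by exact_mod_cast hq.ne_zero)
  · exact h

omit hu in
/-- a non-cube exists in `𝔽_q^×` when `q ≡ 1 (mod 3)`, `q ≥ 5` (`#cubes = (q−1)/3 < q − 1`). -/
theorem exists_nonCube (h1 : q % 3 = 1) : ∃ a : (ZMod q)ˣ, (a : ZMod q) ^ ((q - 1) / 3) ≠ 1 := by
  classical
  have hq : q.Prime := Fact.out
  by_contra h
  push Not at h
  have hall : Finset.univ.filter (fun x : (ZMod q)ˣ => (x : ZMod q) ^ ((q - 1) / 3) = 1) = Finset.univ := by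
    ext x; simp [h x]
  have hcard := card_cubeRoots h1
  rw [hall, Finset.card_univ, ZMod.card_units] at hcard
  have := hq.two_le
  omega

end Cube

end Summit.BirchSwinnertonDyer.BirchSwinnertonDyer.Theorems.CartanTorusCubeCut.PS
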